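import Mathlib
import Literature.Probability.Percolation.DiagonalStripTransferInhomogeneous
import Literature.Probability.Percolation.DiagonalStripTLAction
import HarnessLib

/-!
# Inserting a site into a column of the diagonal strip: index-level tools

Topic `Literature/Probability/Percolation`. Towards Ikhlef–Ponsaing (J. Stat. Phys. 149 (2012),
arXiv:1202.5476) **Lemma 3.3** (the transfer-matrix recursion `t_L(z_{i+1} = q z_i) ∘ φ_i =
φ_i ∘ t_{L-2}(ẑ)`) in the cluster language of `DiagonalStripTransferInhomogeneous.lean`: the
combinatorics of a column layer of the width-`2(n+1)+1` strip seen as the layer of the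
width-`2n+1` strip with one site inserted.

* `eqvGen_map_iff` — transport of equivalence closures along a map with connected fibres whose
  generators correspond (no surjectivity needed); `eqvGen_add_leaf_iff` — hanging a leaf;
* `ipTransferWIdx`, `ipTransferW_eq_idx` — the weighted one-layer kernel as a Bernoulli sum over
  sets of index pairs `(i, j)` (old site `i`, new site `j`) of `latticeIdx m c`;
* `insSrcIdx a` / `insTgtIdx a` — the old lattice edge `(i, j)` seen in the big layer after inserting
  the source site `a` (resp. the target site `a`), and **`latticeIdx_succ_eq_insSrc`** /
  **`latticeIdx_succ_eq_insTgt`**: the big layer is the injective image of the small one plus the two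
  new edges at the inserted site; `predAbove_insSrcIdx_snd`, `predAbove_insTgtIdx_fst` — the shifted
  endpoints project back along `Fin.predAbove`;
* update tools: `colUpdate_fst_iff`, `colUpdate_snd_iff`, `colUpdate_congr_of_eqvGen`,
  **`colUpdate_add_leaf`** (a flagless singleton hanging on one open edge is invisible to the update),
  **`colUpdate_insert_of_rel`** (an edge may be moved between joined old sites).

## References

* Y. Ikhlef, A. K. Ponsaing, *Finite-size left-passage probability in percolation*, J. Stat. Phys.
  149 (2012) 10–36, arXiv:1202.5476, §3.1 and Lemma 3.3. [IkhlefPonsaing2012]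
-/

namespace Literature.Probability.Percolation

open Finset Literature.Probability.LatticeModels Literature.Probability.LatticeModels.TemperleyLieb

/-! ### Transport of closures along maps -/

section Transport

variable {V U : Type*}

/-- **Transport of an equivalence closure along a surjection with connected fibres.** If every
generator of `r` maps into the closure of `s`, every generator of `s` lifts to a pair in the closure of
`r`, the fibres of `π` are `r`-connected and `π` is onto, then `EqvGen r x y ↔ EqvGen s (π x) (π y)`.
[folklore] -/
theorem eqvGen_map_iff (π : V → U) {r : V → V → Prop} {s : U → U → Prop}
    (hrs : ∀ x y, r x y → Relation.EqvGen s (π x) (π y))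
    (hsr : ∀ u v, s u v → ∃ x y, π x = u ∧ π y = v ∧ Relation.EqvGen r x y)
    (hker : ∀ x y, π x = π y → Relation.EqvGen r x y) (x y : V) :
    Relation.EqvGen r x y ↔ Relation.EqvGen s (π x) (π y) := by
  constructor
  · intro h
    induction h with
    | rel x y h => exact hrs x y h
    | refl x => exact Relation.EqvGen.refl _
    | symm x y _ ih => exact Relation.EqvGen.symm _ _ ih
    | trans x y z _ _ ih1 ih2 => exact Relation.EqvGen.trans _ _ _ ih1 ih2
  · suffices H : ∀ u v, Relation.EqvGen s u v →
        ((∃ x, π x = u) ↔ (∃ y, π y = v)) ∧ ∀ x y, π x = u → π y = v → Relation.EqvGen r x y from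
      fun h => (H _ _ h).2 x y rfl rfl
    intro u v h
    induction h with
    | rel u v h =>
      obtain ⟨x', y', hx', hy', h'⟩ := hsr u v h
      refine ⟨iff_of_true ⟨x', hx'⟩ ⟨y', hy'⟩, fun x y hx hy => ?_⟩
      exact Relation.EqvGen.trans _ _ _ (hker x x' (hx.trans hx'.symm))
        (Relation.EqvGen.trans _ _ _ h' (hker y' y (hy'.trans hy.symm)))
    | refl u => exact ⟨Iff.rfl, fun x y hx hy => hker x y (hx.trans hy.symm)⟩
    | symm u v _ ih => exact ⟨ih.1.symm, fun x y hx hy => Relation.EqvGen.symm _ _ (ih.2 y x hy hx)⟩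
    | trans u v w _ _ ih1 ih2 =>
      refine ⟨ih1.1.trans ih2.1, fun x z hx hz => ?_⟩
      obtain ⟨y, hy⟩ := ih1.1.1 ⟨x, hx⟩
      exact Relation.EqvGen.trans _ _ _ (ih1.2 x y hx hy) (ih2.2 y z hy hz)

/-- Closures agree when the generators of each lie in the closure of the other. [folklore] -/
theorem eqvGen_iff_of_le_of_le {r s : V → V → Prop} (h₁ : ∀ x y, r x y → Relation.EqvGen s x y)
    (h₂ : ∀ x y, s x y → Relation.EqvGen r x y) (x y : V) :
    Relation.EqvGen r x y ↔ Relation.EqvGen s x y :=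
  ⟨eqvGen_le_eqvGen h₁ x y, eqvGen_le_eqvGen h₂ x y⟩

/-- **Attaching a leaf.** If `j` is related only to itself, then for `x, y ≠ j` the closure of
`r ∪ {(t,j),(j,t)}` between `x` and `y` is the closure of `r`. [folklore] -/
theorem eqvGen_add_leaf_iff [DecidableEq V] {r : V → V → Prop} {j t : V} (htj : t ≠ j)
    (hj : ∀ y, (r j y ∨ r y j) → y = j) {x y : V} (hx : x ≠ j) (hy : y ≠ j) :
    Relation.EqvGen (fun a b => r a b ∨ (a = t ∧ b = j) ∨ (a = j ∧ b = t)) x y ↔ Relation.EqvGen r x y := by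
  -- `s` = the generators of `r` away from `j`; `π` = `j ↦ t`
  let s : V → V → Prop := fun a b => r a b ∧ a ≠ j ∧ b ≠ j
  let π : V → V := fun a => if a = j then t else a
  have hπx : π x = x := if_neg hx
  have hπy : π y = y := if_neg hy
  -- generators of `r` lie in the closure of `s` except loops at `j`
  have hr_s : ∀ a b, r a b → Relation.EqvGen s a b := by
    intro a b hab
    by_cases ha : a = j
    · have hb : b = j := hj b (Or.inl (ha ▸ hab))
      rw [ha, hb]; exact Relation.EqvGen.refl _
    · by_cases hb : b = j
      · exact absurd (hj a (Or.inr (hb ▸ hab))) ha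
      · exact Relation.EqvGen.rel _ _ ⟨hab, ha, hb⟩
  have forward : ∀ a b, Relation.EqvGen (fun a b => r a b ∨ (a = t ∧ b = j) ∨ (a = j ∧ b = t)) a b →
      Relation.EqvGen s (π a) (π b) := by
    intro a b h
    induction h with
    | rel a b h =>
      rcases h with h | ⟨ha, hb⟩ | ⟨ha, hb⟩
      · by_cases ha : a = j
        · have hb : b = j := hj b (Or.inl (ha ▸ h))
          rw [ha, hb]; exact Relation.EqvGen.refl _
        · by_cases hb : b = j
          · exact absurd (hj a (Or.inr (hb ▸ h))) ha
          · have ha' : π a = a := if_neg ha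
            have hb' : π b = b := if_neg hb
            rw [ha', hb']
            exact Relation.EqvGen.rel _ _ ⟨h, ha, hb⟩
      · have h1 : π b = t := by rw [hb]; exact if_pos rfl
        have h2 : π a = a := by rw [ha]; exact if_neg htj
        rw [h1, h2, ha]; exact Relation.EqvGen.refl _
      · have h1 : π a = t := by rw [ha]; exact if_pos rfl
        have h2 : π b = b := by rw [hb]; exact if_neg htj
        rw [h1, h2, hb]; exact Relation.EqvGen.refl _
    | refl a => exact Relation.EqvGen.refl _
    | symm a b _ ih => exact Relation.EqvGen.symm _ _ ih
    | trans a b c _ _ ih1 ih2 => exact Relation.EqvGen.trans _ _ _ ih1 ih2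
  constructor
  · intro h
    have h' := forward x y h
    rw [hπx, hπy] at h'
    exact eqvGen_le_eqvGen (fun a b hab => Relation.EqvGen.rel _ _ hab.1) x y h'
  · intro h
    have h' : Relation.EqvGen s x y := eqvGen_le_eqvGen hr_s x y h
    exact eqvGen_le_eqvGen (fun a b hab => Relation.EqvGen.rel _ _ (Or.inl hab.1)) x y h'

end Transport

/-! ### Values of `succAbove` / `predAbove` and the partial inverse `unshift` -/

section FinTools

variable {n : ℕ}

/-- The value of `succAbove`. [folklore] -/
theorem val_succAbove (p : Fin (n + 1)) (i : Fin n) :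
    ((p.succAbove i : Fin (n + 1)) : ℕ) = if (i : ℕ) < p then (i : ℕ) else i + 1 := by
  unfold Fin.succAbove
  split_ifs with h1 h2 h2
  · rfl
  · exact absurd (Fin.lt_def.1 h1) (by simpa using h2)
  · exact absurd h2 (by simpa [Fin.lt_def] using h1)
  · simp

/-- The value of `predAbove`. [folklore] -/
theorem val_predAbove (p : Fin n) (i : Fin (n + 1)) :
    ((p.predAbove i : Fin n) : ℕ) = if (i : ℕ) ≤ p then (i : ℕ) else i - 1 := by
  unfold Fin.predAbove
  split_ifs with h1 h2 h2
  · exact absurd (Fin.lt_def.1 h1) (by simp only [Fin.val_castSucc]; omega)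
  · simp
  · simp
  · exact absurd h2 (by simp only [Fin.lt_def, Fin.val_castSucc] at h1; omega)

/-- The partial inverse of `a.succAbove` (junk value at `a`). [folklore] -/
def unshift (a i : Fin (n + 2)) : Fin (n + 1) :=
  ⟨if (i : ℕ) < a then i else i - 1, by
    have := i.2; have := a.2; split_ifs <;> omega⟩

/-- The value of `unshift`. [folklore] -/
@[simp] theorem val_unshift (a i : Fin (n + 2)) :
    ((unshift a i : Fin (n + 1)) : ℕ) = if (i : ℕ) < a then (i : ℕ) else i - 1 := rfl

/-- `unshift a` inverts `a.succAbove`. [folklore] -/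
@[simp] theorem unshift_succAbove (a : Fin (n + 2)) (i : Fin (n + 1)) : unshift a (a.succAbove i) = i := by
  apply Fin.ext
  rw [val_unshift, val_succAbove]
  split_ifs <;> omega

/-- `a.succAbove` inverts `unshift a` away from `a`. [folklore] -/
theorem succAbove_unshift {a i : Fin (n + 2)} (h : i ≠ a) : a.succAbove (unshift a i) = i := by
  apply Fin.ext
  have h' : (i : ℕ) ≠ a := fun h' => h (Fin.ext h')
  rw [val_succAbove, val_unshift]
  split_ifs <;> omega

/-- A site other than `a` is a shifted site. [folklore] -/
theorem eq_succAbove_unshift {a i : Fin (n + 2)} (h : i ≠ a) : ∃ i', a.succAbove i' = i :=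
  ⟨unshift a i, succAbove_unshift h⟩

end FinTools

/-! ### The layer kernel as a sum over index pairs -/

section IdxKernel

variable {K : Type*} [Field K] {m : ℕ}

/-- The edge layer read off a set of index pairs. [folklore] -/
def idxEdgeFn (I : Finset (Fin (m + 1) × Fin (m + 1))) : Fin (m + 1) → Fin (m + 1) → Bool :=
  fun i j => decide ((i, j) ∈ I)

/-- Unfolding of `idxEdgeFn`. [folklore] -/
@[simp] theorem idxEdgeFn_apply (I : Finset (Fin (m + 1) × Fin (m + 1))) (i j : Fin (m + 1)) :
    idxEdgeFn I i j = decide ((i, j) ∈ I) := rfl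

/-- **The weighted one-layer kernel as a sum over sets of index pairs** (weights `ω (i, j)` on the
lattice edge from old site `i` to new site `j`). [cite: IkhlefPonsaing2012, Def. 3.3] -/
noncomputable def ipTransferWIdx (m : ℕ) (c : ℤ) (ω : Fin (m + 1) × Fin (m + 1) → K) (P P' : ColPattern m) : K :=
  ∑ I ∈ (latticeIdx m c).powerset,
    if colUpdate m c P (idxEdgeFn I) = P' then (∏ p ∈ I, ω p) * ∏ p ∈ latticeIdx m c \ I, (1 - ω p) else 0

/-- The pair map of a layer as an embedding. [folklore] -/
def layerEmb (m : ℕ) (c : ℤ) : Fin (m + 1) × Fin (m + 1) ↪ Sym2 (Site 2) :=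
  ⟨fun p => s(colSite c p.1, colSite (c + 1) p.2), mk_colSite_injective c⟩

/-- Unfolding of `layerEmb`. [folklore] -/
@[simp] theorem layerEmb_apply (c : ℤ) (p : Fin (m + 1) × Fin (m + 1)) :
    layerEmb m c p = s(colSite c p.1, colSite (c + 1) p.2) := rfl

/-- The edge layer of an embedded index set is the index edge layer. [folklore] -/
theorem edgeFn_image (c : ℤ) (I : Finset (Fin (m + 1) × Fin (m + 1))) :
    edgeFn m c (I.image (layerEmb m c)) = idxEdgeFn I := by
  classical
  funext i j
  simp only [edgeFn, idxEdgeFn_apply]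
  congr 1
  apply propext
  rw [← Finset.mem_map' (layerEmb m c) (a := (i, j)), Finset.map_eq_image]
  rfl

/-- **The weighted layer kernel equals its index form** with `ω = p ∘ layerEmb`.
[cite: IkhlefPonsaing2012, Def. 3.3] -/
theorem ipTransferW_eq_idx (c : ℤ) (p : Sym2 (Site 2) → K) (P P' : ColPattern m) :
    ipTransferW m c p P P' = ipTransferWIdx m c (fun ij => p (layerEmb m c ij)) P P' := by
  classical
  have hinj : Function.Injective (layerEmb m c) := (layerEmb m c).injective
  have hlayer : latticeLayer m c = (latticeIdx m c).image (layerEmb m c) := by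
    rw [latticeLayer_eq_image]; rfl
  unfold ipTransferW ipTransferWIdx
  rw [hlayer, Finset.powerset_image,
    Finset.sum_image fun I _ J _ h => Finset.image_injective hinj h]
  refine Finset.sum_congr rfl fun I _ => ?_
  rw [edgeFn_image, Finset.prod_image fun a _ b _ h => hinj h, ← Finset.image_sdiff _ _ hinj,
    Finset.prod_image fun a _ b _ h => hinj h]

/-- Row sums of the index kernel are `1`. [folklore] -/
theorem sum_ipTransferWIdx (c : ℤ) (ω : Fin (m + 1) × Fin (m + 1) → K) (P : ColPattern m) :
    ∑ P', ipTransferWIdx m c ω P P' = 1 := by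
  classical
  unfold ipTransferWIdx
  rw [Finset.sum_comm]
  have : ∀ I ∈ (latticeIdx m c).powerset,
      (∑ P' : ColPattern m, if colUpdate m c P (idxEdgeFn I) = P' then
        (∏ p ∈ I, ω p) * ∏ p ∈ latticeIdx m c \ I, (1 - ω p) else 0) =
        (∏ p ∈ I, ω p) * ∏ p ∈ latticeIdx m c \ I, (1 - ω p) := fun I _ => by
    rw [Finset.sum_ite_eq]; simp
  rw [Finset.sum_congr rfl this, ← Finset.prod_add]
  simp

end IdxKernel

/-! ### Lattice index pairs -/

section LatticeIdx

variable {m : ℕ}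

/-- Membership in the lattice index pairs, on values. [folklore] -/
theorem mem_latticeIdx_iff (c : ℤ) (p : Fin (m + 1) × Fin (m + 1)) :
    p ∈ latticeIdx m c ↔ ((p.2 : ℕ) : ℤ) = p.1 ∨ ((p.1 : ℕ) : ℤ) - p.2 = 1 - 2 * (c % 2) := by
  simp [latticeIdx]

end LatticeIdx

/-! ### Inserting a source site: the edge correspondence -/

section InsSrc

variable {n : ℕ}

/-- **The old edge `(i, j)` seen in the big layer after inserting a source site at `a`**: the source
is shifted by `succAbove`, the target is shifted iff the source is. [folklore] -/
def insSrcIdx (a : Fin (n + 2)) (ij : Fin (n + 1) × Fin (n + 1)) : Fin (n + 2) × Fin (n + 2) :=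
  (a.succAbove ij.1, if (ij.1 : ℕ) < a then ij.2.castSucc else ij.2.succ)

/-- Values of `insSrcIdx`. [folklore] -/
theorem val_insSrcIdx (a : Fin (n + 2)) (ij : Fin (n + 1) × Fin (n + 1)) :
    (((insSrcIdx a ij).1 : ℕ) = if (ij.1 : ℕ) < a then (ij.1 : ℕ) else ij.1 + 1) ∧
      (((insSrcIdx a ij).2 : ℕ) = if (ij.1 : ℕ) < a then (ij.2 : ℕ) else ij.2 + 1) := by
  refine ⟨val_succAbove a ij.1, ?_⟩
  unfold insSrcIdx
  dsimp only
  split_ifs <;> rfl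

/-- `insSrcIdx a` is injective. [folklore] -/
theorem insSrcIdx_injective (a : Fin (n + 2)) : Function.Injective (insSrcIdx a) := by
  intro p q h
  have h1 : ((insSrcIdx a p).1 : ℕ) = (insSrcIdx a q).1 := by rw [h]
  have h2 : ((insSrcIdx a p).2 : ℕ) = (insSrcIdx a q).2 := by rw [h]
  rw [(val_insSrcIdx a p).1, (val_insSrcIdx a q).1] at h1
  rw [(val_insSrcIdx a p).2, (val_insSrcIdx a q).2] at h2
  have := p.1.2; have := p.2.2; have := q.1.2; have := q.2.2
  refine Prod.ext (Fin.ext ?_) (Fin.ext ?_) <;> split_ifs at h1 h2 <;> omega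

/-- The new source site is not the source of an old edge. [folklore] -/
theorem insSrcIdx_fst_ne (a : Fin (n + 2)) (ij : Fin (n + 1) × Fin (n + 1)) : (insSrcIdx a ij).1 ≠ a :=
  Fin.succAbove_ne a ij.1

/-- **The big layer after inserting the source site `a`** consists of the shifted old edges and the
two new edges from `a` to `j₀.castSucc` and `j₀.succ`, where `j₀ + 1 = a` on an even source column and
`j₀ = a` on an odd one. [folklore] -/
theorem latticeIdx_succ_eq_insSrc (c : ℤ) (a : Fin (n + 2)) (j₀ : Fin (n + 1))
    (haj : (c % 2 = 0 ∧ (a : ℕ) = j₀ + 1) ∨ (c % 2 = 1 ∧ (a : ℕ) = j₀)) :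
    latticeIdx (n + 1) c =
      (latticeIdx n c).image (insSrcIdx a) ∪ {(a, j₀.castSucc), (a, j₀.succ)} := by
  have ha2 := a.2; have hj₀ := j₀.2
  ext ⟨i', j'⟩
  have hi'2 := i'.2; have hj'2 := j'.2
  rw [mem_latticeIdx_iff, Finset.mem_union, Finset.mem_image, Finset.mem_insert, Finset.mem_singleton]
  simp only [Prod.mk.injEq]
  constructor
  · intro h
    by_cases hi : i' = a
    · subst hi
      right
      simp only [true_and, Fin.ext_iff, Fin.val_castSucc, Fin.val_succ]
      rcases haj with ⟨hc, ha⟩ | ⟨hc, ha⟩ <;> rw [hc] at h <;> omega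
    · left
      obtain ⟨i, rfl⟩ := eq_succAbove_unshift hi
      have hi2 := i.2
      have hvi := val_succAbove a i
      by_cases h1 : (i : ℕ) < a
      · rw [if_pos h1] at hvi
        rw [hvi] at h
        have hj' : (j' : ℕ) < n + 1 := by
          rcases haj with ⟨hc, ha⟩ | ⟨hc, ha⟩ <;> rw [hc] at h <;> omega
        refine ⟨(i, ⟨j', hj'⟩), ?_, ?_⟩
        · rw [mem_latticeIdx_iff]; dsimp only
          rcases haj with ⟨hc, ha⟩ | ⟨hc, ha⟩ <;> rw [hc] at h ⊢ <;> omega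
        · refine Prod.ext rfl (Fin.ext ?_)
          rw [(val_insSrcIdx a _).2]; dsimp only; rw [if_pos h1]
      · rw [if_neg h1] at hvi
        rw [hvi] at h
        have hj' : (j' : ℕ) - 1 < n + 1 ∧ 1 ≤ (j' : ℕ) := by
          rcases haj with ⟨hc, ha⟩ | ⟨hc, ha⟩ <;> rw [hc] at h <;> omega
        refine ⟨(i, ⟨(j' : ℕ) - 1, hj'.1⟩), ?_, ?_⟩
        · rw [mem_latticeIdx_iff]; dsimp only
          rcases haj with ⟨hc, ha⟩ | ⟨hc, ha⟩ <;> rw [hc] at h ⊢ <;> omega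
        · refine Prod.ext rfl (Fin.ext ?_)
          rw [(val_insSrcIdx a _).2]; dsimp only; rw [if_neg h1]; omega
  · rintro (⟨⟨i, j⟩, hij, hEq⟩ | ⟨rfl, rfl⟩ | ⟨rfl, rfl⟩)
    · rw [mem_latticeIdx_iff] at hij
      have hi2 := i.2; have hj2 := j.2
      have h1 : ((insSrcIdx a (i, j)).1 : ℕ) = i' := by rw [hEq]
      have h2 : ((insSrcIdx a (i, j)).2 : ℕ) = j' := by rw [hEq]
      rw [(val_insSrcIdx a _).1] at h1
      rw [(val_insSrcIdx a _).2] at h2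
      dsimp only at h1 h2 hij
      rcases haj with ⟨hc, ha⟩ | ⟨hc, ha⟩ <;> rw [hc] at hij ⊢ <;> split_ifs at h1 h2 <;> omega
    · simp only [Fin.val_castSucc]
      rcases haj with ⟨hc, ha⟩ | ⟨hc, ha⟩ <;> rw [hc] <;> omega
    · simp only [Fin.val_succ]
      rcases haj with ⟨hc, ha⟩ | ⟨hc, ha⟩ <;> rw [hc] <;> push_cast <;> omega

/-- The two new edges are not shifted old edges. [folklore] -/
theorem insSrcIdx_ne_new (a : Fin (n + 2)) (ij : Fin (n + 1) × Fin (n + 1)) (t : Fin (n + 2)) :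
    insSrcIdx a ij ≠ (a, t) := fun h => insSrcIdx_fst_ne a ij (congrArg Prod.fst h)

/-- On old lattice edges, the shifted target projects back to the old target along `predAbove j₀`.
[folklore] -/
theorem predAbove_insSrcIdx_snd (c : ℤ) (a : Fin (n + 2)) (j₀ : Fin (n + 1))
    (haj : (c % 2 = 0 ∧ (a : ℕ) = j₀ + 1) ∨ (c % 2 = 1 ∧ (a : ℕ) = j₀)) {ij : Fin (n + 1) × Fin (n + 1)}
    (hij : ij ∈ latticeIdx n c) : j₀.predAbove (insSrcIdx a ij).2 = ij.2 := by
  apply Fin.ext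
  rw [val_predAbove, (val_insSrcIdx a ij).2]
  rw [mem_latticeIdx_iff] at hij
  have := ij.1.2; have := ij.2.2; have := a.2
  rcases haj with ⟨hc, ha⟩ | ⟨hc, ha⟩ <;> rw [hc] at hij <;> split_ifs <;> omega

/-- The two new targets project to `j₀`. [folklore] -/
theorem predAbove_castSucc_self' (j₀ : Fin (n + 1)) : j₀.predAbove j₀.castSucc = j₀ := by
  apply Fin.ext; rw [val_predAbove]; simp

/-- The two new targets project to `j₀`. [folklore] -/
theorem predAbove_succ_self' (j₀ : Fin (n + 1)) : j₀.predAbove j₀.succ = j₀ := by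
  apply Fin.ext; rw [val_predAbove]; simp

/-- A target projecting to `j₀` is one of the two new targets. [folklore] -/
theorem predAbove_eq_self_iff (j₀ : Fin (n + 1)) (j' : Fin (n + 2)) :
    j₀.predAbove j' = j₀ ↔ j' = j₀.castSucc ∨ j' = j₀.succ := by
  rw [Fin.ext_iff, val_predAbove, Fin.ext_iff, Fin.ext_iff, Fin.val_castSucc, Fin.val_succ]
  split_ifs <;> omega

/-- `predAbove j₀` identifies only the two new targets. [folklore] -/
theorem predAbove_eq_predAbove_iff (j₀ : Fin (n + 1)) (j₁ j₂ : Fin (n + 2)) :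
    j₀.predAbove j₁ = j₀.predAbove j₂ ↔
      j₁ = j₂ ∨ (j₁ = j₀.castSucc ∧ j₂ = j₀.succ) ∨ (j₁ = j₀.succ ∧ j₂ = j₀.castSucc) := by
  simp only [Fin.ext_iff, val_predAbove, Fin.val_castSucc, Fin.val_succ]
  split_ifs <;> omega

end InsSrc

/-! ### Inserting a target site: the edge correspondence -/

section InsTgt

variable {m n : ℕ}

/-- Swapping source and target shifts the parity of the layer. [folklore] -/
theorem swap_mem_latticeIdx_iff (c : ℤ) (p : Fin (m + 1) × Fin (m + 1)) :
    p.swap ∈ latticeIdx m (c + 1) ↔ p ∈ latticeIdx m c := by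
  rw [mem_latticeIdx_iff, mem_latticeIdx_iff, Prod.fst_swap, Prod.snd_swap]
  rcases Int.emod_two_eq_zero_or_one c with hc | hc
  · rw [hc, show (c + 1) % 2 = 1 by omega]; omega
  · rw [hc, show (c + 1) % 2 = 0 by omega]; omega

/-- **The old edge `(i, j)` seen in the big layer after inserting a target site at `a`** (the mirror
image of `insSrcIdx`). [folklore] -/
def insTgtIdx (a : Fin (n + 2)) (ij : Fin (n + 1) × Fin (n + 1)) : Fin (n + 2) × Fin (n + 2) :=
  (insSrcIdx a ij.swap).swap

/-- `insTgtIdx` is the conjugate of `insSrcIdx` by swapping. [folklore] -/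
theorem swap_insTgtIdx (a : Fin (n + 2)) (ij : Fin (n + 1) × Fin (n + 1)) :
    (insTgtIdx a ij).swap = insSrcIdx a ij.swap := rfl

/-- The target of a shifted old edge. [folklore] -/
theorem insTgtIdx_snd (a : Fin (n + 2)) (ij : Fin (n + 1) × Fin (n + 1)) :
    (insTgtIdx a ij).2 = a.succAbove ij.2 := rfl

/-- Values of `insTgtIdx`. [folklore] -/
theorem val_insTgtIdx (a : Fin (n + 2)) (ij : Fin (n + 1) × Fin (n + 1)) :
    (((insTgtIdx a ij).1 : ℕ) = if (ij.2 : ℕ) < a then (ij.1 : ℕ) else ij.1 + 1) ∧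
      (((insTgtIdx a ij).2 : ℕ) = if (ij.2 : ℕ) < a then (ij.2 : ℕ) else ij.2 + 1) :=
  ⟨(val_insSrcIdx a ij.swap).2, (val_insSrcIdx a ij.swap).1⟩

/-- `insTgtIdx a` is injective. [folklore] -/
theorem insTgtIdx_injective (a : Fin (n + 2)) : Function.Injective (insTgtIdx a) := by
  intro p q h
  have h' : insSrcIdx a p.swap = insSrcIdx a q.swap := by
    rw [← swap_insTgtIdx, ← swap_insTgtIdx, h]
  exact Prod.swap_inj.1 (insSrcIdx_injective a h')

/-- The new target site is not the target of an old edge. [folklore] -/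
theorem insTgtIdx_snd_ne (a : Fin (n + 2)) (ij : Fin (n + 1) × Fin (n + 1)) : (insTgtIdx a ij).2 ≠ a :=
  insSrcIdx_fst_ne a ij.swap

/-- **The big layer after inserting the target site `a`**: the shifted old edges and the two new edges
into `a` from `j₀.castSucc` and `j₀.succ`, where `j₀ = a` on an even source column and `j₀ + 1 = a`
on an odd one. [folklore] -/
theorem latticeIdx_succ_eq_insTgt (c : ℤ) (a : Fin (n + 2)) (j₀ : Fin (n + 1))
    (haj : (c % 2 = 0 ∧ (a : ℕ) = j₀) ∨ (c % 2 = 1 ∧ (a : ℕ) = j₀ + 1)) :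
    latticeIdx (n + 1) c =
      (latticeIdx n c).image (insTgtIdx a) ∪ {(j₀.castSucc, a), (j₀.succ, a)} := by
  classical
  have haj' : ((c + 1) % 2 = 0 ∧ (a : ℕ) = j₀ + 1) ∨ ((c + 1) % 2 = 1 ∧ (a : ℕ) = j₀) := by omega
  have H := latticeIdx_succ_eq_insSrc (c + 1) a j₀ haj'
  ext ⟨i', j'⟩
  rw [← swap_mem_latticeIdx_iff, Prod.swap_prod_mk, H]
  simp only [Finset.mem_union, Finset.mem_image, Finset.mem_insert, Finset.mem_singleton, Prod.mk.injEq]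
  constructor
  · rintro (⟨q, hq, hqp⟩ | ⟨h1, h2⟩ | ⟨h1, h2⟩)
    · refine Or.inl ⟨q.swap, (swap_mem_latticeIdx_iff c q.swap).1 (by rw [Prod.swap_swap]; exact hq), ?_⟩
      show (insSrcIdx a q.swap.swap).swap = (i', j')
      rw [Prod.swap_swap, hqp]; rfl
    · exact Or.inr (Or.inl ⟨h2, h1⟩)
    · exact Or.inr (Or.inr ⟨h2, h1⟩)
  · rintro (⟨q, hq, hqp⟩ | ⟨h1, h2⟩ | ⟨h1, h2⟩)
    · refine Or.inl ⟨q.swap, (swap_mem_latticeIdx_iff c q).2 hq, ?_⟩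
      rw [← swap_insTgtIdx, hqp]; rfl
    · exact Or.inr (Or.inl ⟨h2, h1⟩)
    · exact Or.inr (Or.inr ⟨h2, h1⟩)

/-- On old lattice edges, the shifted source projects back to the old source along `predAbove j₀`.
[folklore] -/
theorem predAbove_insTgtIdx_fst (c : ℤ) (a : Fin (n + 2)) (j₀ : Fin (n + 1))
    (haj : (c % 2 = 0 ∧ (a : ℕ) = j₀) ∨ (c % 2 = 1 ∧ (a : ℕ) = j₀ + 1)) {ij : Fin (n + 1) × Fin (n + 1)}
    (hij : ij ∈ latticeIdx n c) : j₀.predAbove (insTgtIdx a ij).1 = ij.1 := by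
  have haj' : ((c + 1) % 2 = 0 ∧ (a : ℕ) = j₀ + 1) ∨ ((c + 1) % 2 = 1 ∧ (a : ℕ) = j₀) := by omega
  exact predAbove_insSrcIdx_snd (c + 1) a j₀ haj' ((swap_mem_latticeIdx_iff c ij).2 hij)

end InsTgt

/-! ### The column update: unfolding lemmas and two invariance principles -/

section UpdateTools

variable {m : ℕ}

/-- Unfolding of `updRel` on two old sites. [folklore] -/
@[simp] theorem updRel_inl_inl (P : ColPattern m) (E : Fin (m + 1) → Fin (m + 1) → Bool) (i i' : Fin (m + 1)) :
    updRel m P E (Sum.inl i) (Sum.inl i') ↔ P.1 i i' = true := Iff.rfl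

/-- Unfolding of `updRel` on an old and a new site. [folklore] -/
@[simp] theorem updRel_inl_inr (P : ColPattern m) (E : Fin (m + 1) → Fin (m + 1) → Bool) (i j : Fin (m + 1)) :
    updRel m P E (Sum.inl i) (Sum.inr j) ↔ E i j = true := Iff.rfl

/-- Unfolding of `updRel` on a new and an old site. [folklore] -/
@[simp] theorem updRel_inr_inl (P : ColPattern m) (E : Fin (m + 1) → Fin (m + 1) → Bool) (i j : Fin (m + 1)) :
    updRel m P E (Sum.inr j) (Sum.inl i) ↔ E i j = true := Iff.rfl

/-- `updRel` never relates two new sites directly. [folklore] -/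
@[simp] theorem updRel_inr_inr (P : ColPattern m) (E : Fin (m + 1) → Fin (m + 1) → Bool) (j j' : Fin (m + 1)) :
    ¬ updRel m P E (Sum.inr j) (Sum.inr j') := id

/-- Unfolding of `updWall` on an old site. [folklore] -/
@[simp] theorem updWall_inl (c : ℤ) (P : ColPattern m) (i : Fin (m + 1)) :
    updWall m c P (Sum.inl i) ↔ P.2 i = true := Iff.rfl

/-- Unfolding of `updWall` on a new site. [folklore] -/
@[simp] theorem updWall_inr (c : ℤ) (P : ColPattern m) (j : Fin (m + 1)) :
    updWall m c P (Sum.inr j) ↔ (c + 1) % 2 = 0 ∧ (j : ℕ) = 0 := Iff.rfl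

/-- The relation of the updated pattern. [folklore] -/
theorem colUpdate_fst_iff (c : ℤ) (P : ColPattern m) (E : Fin (m + 1) → Fin (m + 1) → Bool) (j j' : Fin (m + 1)) :
    (colUpdate m c P E).1 j j' = true ↔ Relation.EqvGen (updRel m P E) (Sum.inr j) (Sum.inr j') := by
  classical
  simp only [colUpdate, decide_eq_true_eq]

/-- The flags of the updated pattern. [folklore] -/
theorem colUpdate_snd_iff (c : ℤ) (P : ColPattern m) (E : Fin (m + 1) → Fin (m + 1) → Bool) (j : Fin (m + 1)) :
    (colUpdate m c P E).2 j = true ↔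
      ∃ z, Relation.EqvGen (updRel m P E) (Sum.inr j) z ∧ updWall m c P z := by
  classical
  simp only [colUpdate, decide_eq_true_eq]

/-- The updated pattern is reflexive. [folklore] -/
theorem colUpdate_fst_self (c : ℤ) (P : ColPattern m) (E : Fin (m + 1) → Fin (m + 1) → Bool) (j : Fin (m + 1)) :
    (colUpdate m c P E).1 j j = true := by
  rw [colUpdate_fst_iff]; exact Relation.EqvGen.refl _

/-- **The update depends on the open edges only through the closure of the one-step relation.**
[folklore] -/
theorem colUpdate_congr_of_eqvGen (c : ℤ) (P : ColPattern m) {E₁ E₂ : Fin (m + 1) → Fin (m + 1) → Bool}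
    (h : ∀ x y, Relation.EqvGen (updRel m P E₁) x y ↔ Relation.EqvGen (updRel m P E₂) x y) :
    colUpdate m c P E₁ = colUpdate m c P E₂ :=
  colUpdate_ext h (fun z hz => ⟨z, Relation.EqvGen.refl _, hz⟩) fun z hz => ⟨z, Relation.EqvGen.refl _, hz⟩

/-- **Hanging a singleton on one edge changes nothing.** If the old site `s` is a singleton of `P`
without wall flag and without open edges in `E`, then additionally opening the single edge `(s, t)`
does not change the update. [folklore] -/
theorem colUpdate_add_leaf (c : ℤ) (P : ColPattern m) {E E' : Fin (m + 1) → Fin (m + 1) → Bool}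
    (s t : Fin (m + 1)) (hs1 : ∀ i, P.1 s i = true → i = s) (hs2 : ∀ i, P.1 i s = true → i = s)
    (hs3 : P.2 s = false) (hsE : ∀ j, E s j = false)
    (hE' : ∀ i j, E' i j = true ↔ E i j = true ∨ (i = s ∧ j = t)) :
    colUpdate m c P E' = colUpdate m c P E := by
  classical
  have hrel : updRel m P E' = fun a b => updRel m P E a b ∨
      (a = Sum.inr t ∧ b = Sum.inl s) ∨ (a = Sum.inl s ∧ b = Sum.inr t) := by
    funext a b
    apply propext
    rcases a with i | j <;> rcases b with i' | j'
    · simp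
    · simp only [updRel_inl_inr, hE', Sum.inl.injEq, Sum.inr.injEq, reduceCtorEq, false_and, false_or]
    · simp only [updRel_inr_inl, hE', Sum.inl.injEq, Sum.inr.injEq, reduceCtorEq, false_and, or_false]
      tauto
    · simp
  have hleaf : ∀ y, (updRel m P E (Sum.inl s) y ∨ updRel m P E y (Sum.inl s)) → y = Sum.inl s := by
    rintro (i | j) h
    · simp only [updRel_inl_inl] at h
      rcases h with h | h
      · rw [hs1 i h]
      · rw [hs2 i h]
    · simp only [updRel_inl_inr, updRel_inr_inl, hsE, or_self] at h
      exact absurd h Bool.false_ne_true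
  have key : ∀ x y, x ≠ Sum.inl s → y ≠ Sum.inl s →
      (Relation.EqvGen (updRel m P E') x y ↔ Relation.EqvGen (updRel m P E) x y) := by
    intro x y hx hy
    rw [hrel]
    exact eqvGen_add_leaf_iff (by simp) hleaf hx hy
  refine Prod.ext (funext fun j => funext fun j' => ?_) (funext fun j => ?_)
  · rw [Bool.eq_iff_iff, colUpdate_fst_iff, colUpdate_fst_iff]
    exact key _ _ (by simp) (by simp)
  · rw [Bool.eq_iff_iff, colUpdate_snd_iff, colUpdate_snd_iff]
    refine exists_congr fun z => ?_
    by_cases hz : z = Sum.inl s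
    · subst hz; simp [hs3]
    · rw [key _ _ (by simp) hz]

/-- Opening an edge from `i₁` or from a site `i₂` joined to `i₁` in `P` gives the same update.
[folklore] -/
theorem colUpdate_insert_of_rel (c : ℤ) (P : ColPattern m) {i₁ i₂ : Fin (m + 1)} (h₁₂ : P.1 i₁ i₂ = true)
    (h₂₁ : P.1 i₂ i₁ = true) (t : Fin (m + 1)) (J : Finset (Fin (m + 1) × Fin (m + 1))) :
    colUpdate m c P (idxEdgeFn (insert (i₁, t) J)) = colUpdate m c P (idxEdgeFn (insert (i₂, t) J)) := by
  classical
  -- one generator set inside the closure of the other, by symmetry of the statement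
  suffices H : ∀ {i₁ i₂ : Fin (m + 1)}, P.1 i₁ i₂ = true → P.1 i₂ i₁ = true → ∀ x y,
      updRel m P (idxEdgeFn (insert (i₁, t) J)) x y →
        Relation.EqvGen (updRel m P (idxEdgeFn (insert (i₂, t) J))) x y from
    colUpdate_congr_of_eqvGen c P (eqvGen_iff_of_le_of_le (H h₁₂ h₂₁) (H h₂₁ h₁₂))
  intro i₁ i₂ h₁₂ h₂₁ x y hxy
  have hpath : Relation.EqvGen (updRel m P (idxEdgeFn (insert (i₂, t) J))) (Sum.inl i₁) (Sum.inr t) :=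
    Relation.EqvGen.trans _ (Sum.inl i₂) _ (Relation.EqvGen.rel _ _ (by simpa using h₁₂))
      (Relation.EqvGen.rel _ _ (by simp))
  rcases x with i | j <;> rcases y with i' | j'
  · exact Relation.EqvGen.rel _ _ hxy
  · simp only [updRel_inl_inr, idxEdgeFn_apply, Finset.mem_insert, Prod.mk.injEq, decide_eq_true_eq] at hxy
    rcases hxy with ⟨rfl, rfl⟩ | h
    · exact hpath
    · exact Relation.EqvGen.rel _ _ (by simp [h])
  · simp only [updRel_inr_inl, idxEdgeFn_apply, Finset.mem_insert, Prod.mk.injEq, decide_eq_true_eq] at hxy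
    rcases hxy with ⟨rfl, rfl⟩ | h
    · exact Relation.EqvGen.symm _ _ hpath
    · exact Relation.EqvGen.rel _ _ (by simp [h])
  · exact absurd hxy (updRel_inr_inr _ _ _ _)

/-- Opening both edges `(i₁, t)`, `(i₂, t)` from joined sites is the same as opening one. [folklore] -/
theorem colUpdate_insert_insert_of_rel (c : ℤ) (P : ColPattern m) {i₁ i₂ : Fin (m + 1)}
    (h₁₂ : P.1 i₁ i₂ = true) (h₂₁ : P.1 i₂ i₁ = true) (t : Fin (m + 1))
    (J : Finset (Fin (m + 1) × Fin (m + 1))) :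
    colUpdate m c P (idxEdgeFn (insert (i₁, t) (insert (i₂, t) J))) =
      colUpdate m c P (idxEdgeFn (insert (i₂, t) J)) := by
  classical
  rw [colUpdate_insert_of_rel c P h₁₂ h₂₁ t (insert (i₂, t) J), Finset.insert_idem]

end UpdateTools

end Literature.Probability.Percolation
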